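import Summits.ResolutionOfSingularities.ResolutionOfSingularities.Theorems.EquisingularLiftEquisingularLiftNatCrossedLetterTransport
import Summits.ResolutionOfSingularities.ResolutionOfSingularities.Theorems.EquisingularLiftCampaignW45bULTHorizontalBridge
import Mathlib.AlgebraicGeometry.Morphisms.FiniteType
import Mathlib.Topology.JacobsonSpace
import HarnessLib

/-!
# [OURS · L1 W4.5(b) · EL♮(3) · WIDTH TABLE D8 «NODAL HOSTED ROUND (HR-KEEP-N)», support debt S-D8-LIFT, part 1] A CROSSED LETTER STEPS TO ITS
# STRICT TRANSFORM ACROSS A **NODAL** CENTRE TRACE — the (CL) bridge WITHOUT «`Z̃` regular»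
# `crossing_stalkwise_of_curve_trace_jacobson` and `TCPlus.crossedLetter_clausesN`

res-L1-w45b-stub-4 g14 (desk R69 (iii): S-D8-LIFT booked as stub-4's support debt; plan of record `L/res-L1-w45b-stub-4/g13/S-D8-LIFT-PLAN.md`,
step (1)).  OURS; NOT a statement of any manuscript ([Hironaka2017] is a candidate under adjudication, nothing of it is asserted); AI-written, weaker
than expert review.  No `sorry`; standard axioms; DEF-FREE.  `--supports stmt-ResolutionOfSingularities-20148 --as helper`.

WHY.  By the bytes of ✓ `TCPlus.hround_keep` (…NatHostedRoundKeep) the binder «`Z̃` regular» — the one that the nodal supplier `NodalHostedRoundFact`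
(✓ p693330, …NatNodalHostedRoundDefs) replaces by (N1) «finitely many non-regular points» — is read in exactly two places: the lift (T-k), and the
(CL) bridge ✓ `crossing_stalkwise_of_curve_trace` (…NatCrossedLetterTransport l.112), where it serves ONLY to make `𝒪_{G,g} ⧸ 𝓘⟨Z⟩_g` a domain at a
closed crossing point `g`, so that ✓ `sup_eq_maximalIdeal_of_isRadical_of_not_le` applies.  This file removes the second reading: the bridge holds for
ANY reduced closed curve `Z` (one-dimensional local rings at its closed points, no regularity whatsoever) on a locally Noetherian quasi-compact
JACOBSON scheme `G` — and the special fibre `G = F₁` of the chain is Jacobson (locally of finite type over `Spec k`).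

WHAT.
* `sup_eq_maximalIdeal_of_isRadical_of_forall_minimalPrimes` — local algebra: in a local ring `R`, for an ideal `I` with `dim R⧸I ≤ 1` and an ideal `J`
  contained in NO minimal prime of `I`, if `I ⊔ J` is radical and proper then `I ⊔ J = 𝔪_R` (every prime `Q ⊇ I ⊔ J` contains a minimal prime `P` of
  `I`; in the domain `R ⧸ P` of dimension `≤ 1` the image of `Q` is non-zero, hence maximal).
* `stalkIdeal_vanishingIdeal_le_of_notMem_closure_diff` — the germ of `𝓘⟨·⟩` is local: for closed `Z, Z₁` and a point `z ∉ closure (Z ∖ Z₁)`,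
  `𝓘⟨Z₁⟩_z ≤ 𝓘⟨Z⟩_z` (Literature `stalkIdeal_vanishingIdeal_eq_vanishingIdeal_setOf`: a generisation of `z` in `Z` is not in the closed set
  `closure (Z ∖ Z₁) ∌ z`, hence lies in `Z₁`).
* ★ `crossing_stalkwise_of_curve_trace_jacobson` — ✓ `crossing_stalkwise_of_curve_trace` with the binder «`Z̃` regular» REPLACED by `[JacobsonSpace G]`:
  `Z, F ⊆ G` closed, one-dimensional local rings of `Z̃` at its closed points, the REDUCED CROSSING `𝓘⟨F⟩ ⊔ 𝓘⟨Z⟩ = 𝓘⟨F ∩ Z⟩`, and NO BRANCH of `Z` inside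
  `F` in the typed form «`𝓘⟨F⟩_z ⊄ 𝓘⟨Z⟩_z` at every closed `z ∈ Z`» ⟹ (T1) `𝓘⟨Z⟩_g ⊔ 𝓘⟨F⟩_g = 𝔪_g`, (T2) `𝓘⟨Z⟩_g ≠ 𝔪_g` at every `g ∈ Z ∩ F`, all of
  which are closed points.
* ★ `TCPlus.crossedLetter_clausesN` — ✓ (CL) `TCPlus.crossedLetter_clauses` (the five `LetterDatum` clauses of the strict transform of a crossed letter)
  with the binder `hZreg` DROPPED and nothing else changed; `JacobsonSpace G` is derived inside from the model square (`tG : G ⟶ Spec k` is a base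
  change of the proper, hence locally of finite type, `σ ≫ q`; Mathlib `LocallyOfFiniteType.jacobsonSpace`).
(✓ (CL) `TCPlus.crossedLetter_clauses` is the special case with the idle binder `hZreg`; not restated here.)

PROOF OF THE BRIDGE at a closed crossing point `g` (the only new mathematics; (T2) and «crossing points are closed» are as before).  Let `I = 𝓘⟨Z⟩_g`,
`J = 𝓘⟨F⟩_g`; `I ⊔ J = 𝓘⟨F ∩ Z⟩_g` is radical and proper, `dim 𝒪_g⧸I = 1`.  By the local algebra it suffices that `J` lies in no minimal prime `P` of
`I`.  If `J ≤ P`: by Literature `exists_isMax_of_mem_minimalPrimes` (Stacks 01J7) `P = 𝔭_η` for a generisation `η ⤳ g`, `η ∈ Z`, MAXIMAL in `Z` for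
specialisation (the generic point of a branch `Z₁ = cl{η}` of `Z` through `g`), and `η ∈ F` (`mem_of_stalkIdeal_vanishingIdeal_le`), so `Z₁ ⊆ Z ∩ F`.
The generic point `η` is not in `W = closure (Z ∖ Z₁)` (a point of the locally closed `Z ∖ Z₁` specialising to `η` would equal `η` by maximality —
✓ `Scheme.exists_mem_specializes_of_mem_closure`, locally Noetherian), so `Z₁ ∖ W` is a non-empty locally closed set and, `G` being Jacobson, contains a
CLOSED point `z'` (Mathlib `nonempty_inter_closedPoints`).  At `z'`: `𝓘⟨F⟩_{z'} ≤ 𝓘⟨Z₁⟩_{z'} ≤ 𝓘⟨Z⟩_{z'}` (`F ⊇ Z₁`; locality of the germ off `W`),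
contradicting the no-branch clause at the closed point `z' ∈ Z`.  ∎
[cite: StacksProject, Tag 01J7] [cite: StacksProject, Tag 005U] [cite: Matsumura1987, §5 with Thm. 1.1] [folklore; pure composition otherwise]
-/

set_option linter.dupNamespace false -- mandated namespace `Summit.<Summit>.<Problem>` of this single-conjunct summit
set_option linter.overlappingInstances false -- signatures carry `[IsDomain O] [IsDiscreteValuationRing O]`

noncomputable section

open CategoryTheory CategoryTheory.Limits AlgebraicGeometry TopologicalSpace Topology IsLocalRing
open Literature.AlgebraicGeometry.Resolution
open AlgebraicGeometry.Scheme.IdealSheafData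

namespace Summit.ResolutionOfSingularities.ResolutionOfSingularities.Cruxes.EquisingularLiftNat.Sections

/-! ## Local algebra -/

/-- **In a local ring `R`, for an ideal `I` with `dim R ⧸ I ≤ 1` and an ideal `J` contained in no minimal prime of `I`: if `I ⊔ J` is radical and
proper, then `I ⊔ J = 𝔪_R`.**  Every prime `Q ⊇ I ⊔ J` contains a minimal prime `P ⊇ I`; in the domain `R ⧸ P`, of dimension `≤ dim R ⧸ I ≤ 1`, the
image of `Q` is a NON-ZERO prime (`J ≤ Q`, `J ⊄ P`), hence maximal, so `Q = 𝔪_R`; a radical ideal is the intersection of the primes above it.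
(✓ `sup_eq_maximalIdeal_of_isRadical_of_not_le` is the case `I` prime.) [cite: Matsumura1987, §5 (dimension) with Thm. 1.1] [folklore] -/
theorem sup_eq_maximalIdeal_of_isRadical_of_forall_minimalPrimes {R : Type*} [CommRing R] [IsLocalRing R] {I J : Ideal R}
    (hdim : ringKrullDim (R ⧸ I) ≤ 1) (hJ : ∀ P ∈ I.minimalPrimes, ¬ J ≤ P) (hrad : (I ⊔ J).IsRadical) (hne : I ⊔ J ≠ ⊤) :
    I ⊔ J = maximalIdeal R := by
  refine le_antisymm (IsLocalRing.le_maximalIdeal hne) ?_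
  rw [← hrad.radical, Ideal.radical_eq_sInf]
  refine le_sInf ?_
  rintro Q ⟨hKQ, hQ⟩
  have hIQ : I ≤ Q := le_sup_left.trans hKQ
  obtain ⟨P, hP, hPQ⟩ := Ideal.exists_minimalPrimes_le hIQ
  haveI hPp : P.IsPrime := hP.1.1
  have hIP : I ≤ P := hP.1.2
  -- in the domain `R ⧸ P`, of dimension `≤ 1`
  have hdimP : ringKrullDim (R ⧸ P) ≤ 1 :=
    (ringKrullDim_le_of_surjective (Ideal.Quotient.factor hIP) (Ideal.Quotient.factor_surjective hIP)).trans hdim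
  haveI : Ring.KrullDimLE 1 (R ⧸ P) := Ring.krullDimLE_iff.mpr hdimP
  have hker : RingHom.ker (Ideal.Quotient.mk P) ≤ Q := by rw [Ideal.mk_ker]; exact hPQ
  haveI := hQ
  haveI hQ' : (Q.map (Ideal.Quotient.mk P)).IsPrime := Ideal.map_isPrime_of_surjective Ideal.Quotient.mk_surjective hker
  have hne' : Q.map (Ideal.Quotient.mk P) ≠ ⊥ := by
    intro h
    rw [Ideal.map_eq_bot_iff_le_ker, Ideal.mk_ker] at h
    exact hJ P hP (le_sup_right.trans (hKQ.trans h))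
  haveI hmax' : (Q.map (Ideal.Quotient.mk P)).IsMaximal := hQ'.isMaximal_of_ne_bot hne'
  have hmax : Q.IsMaximal := by
    have h := Ideal.comap_isMaximal_of_surjective (Ideal.Quotient.mk P) Ideal.Quotient.mk_surjective (K := Q.map (Ideal.Quotient.mk P))
    rwa [Ideal.comap_map_of_surjective _ Ideal.Quotient.mk_surjective, ← RingHom.ker_eq_comap_bot, Ideal.mk_ker,
      sup_eq_left.mpr hPQ] at h
  rw [IsLocalRing.eq_maximalIdeal hmax]

/-! ## Locality of the germ of a vanishing ideal -/

/-- **The germ of `𝓘⟨·⟩` only sees the closed set near the point**: for closed `Z, Z₁` and a point `z ∉ closure (Z ∖ Z₁)`, `𝓘⟨Z₁⟩_z ≤ 𝓘⟨Z⟩_z`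
(for `Z₁ ⊆ Z` this is `=`, the other inclusion being monotonicity).  By Literature `stalkIdeal_vanishingIdeal_eq_vanishingIdeal_setOf` both germs are vanishing ideals
of traces on `Spec 𝒪_{G,z}`, i.e. of sets of generisations of `z`; a generisation of `z` lying in `Z` is not in the closed set `closure (Z ∖ Z₁) ∌ z`,
so it lies in `Z₁`. [cite: StacksProject, Tag 01J7] [folklore] -/
theorem stalkIdeal_vanishingIdeal_le_of_notMem_closure_diff {G : Scheme.{0}} {Z Z₁ : Set G} (hZ : IsClosed Z) (hZ₁ : IsClosed Z₁)
    {z : G} (hz : z ∉ closure (Z \ Z₁)) :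
    stalkIdeal (vanishingIdeal (⟨Z₁, hZ₁⟩ : Closeds G)) z ≤ stalkIdeal (vanishingIdeal (⟨Z, hZ⟩ : Closeds G)) z := by
  rw [stalkIdeal_vanishingIdeal_eq_vanishingIdeal_setOf, stalkIdeal_vanishingIdeal_eq_vanishingIdeal_setOf]
  apply PrimeSpectrum.vanishingIdeal_anti_mono
  intro q hq
  -- `y = fromSpecStalk z q ⤳ z` lies in `Z`; it is not in `closure (Z ∖ Z₁)` (else so would be `z`), hence it is in `Z₁`
  have hy : G.fromSpecStalk z q ⤳ z := fromSpecStalk_specializes q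
  have hqZ : G.fromSpecStalk z q ∈ Z := hq
  by_contra hq₁
  have hmem : G.fromSpecStalk z q ∈ Z \ Z₁ := ⟨hqZ, hq₁⟩
  exact hz (hy.mem_closed isClosed_closure (subset_closure hmem))

/-! ## The bridge without regularity of `Z̃` -/

/-- **THE BRIDGE, NODAL VERSION** — ✓ `crossing_stalkwise_of_curve_trace` with «`Z̃` regular» replaced by `[JacobsonSpace G]`.  `G` locally Noetherian,
quasi-compact, Jacobson; `Z, F ⊆ G` closed; the reduced curve `Z̃ = V(𝓘⟨Z⟩)` has one-dimensional local rings at its closed points (nodes, cusps, any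
curve singularities allowed); the REDUCED CROSSING `𝓘⟨F⟩ ⊔ 𝓘⟨Z⟩ = 𝓘⟨F ∩ Z⟩`; and NO BRANCH of `Z` inside `F`: `𝓘⟨F⟩_z ⊄ 𝓘⟨Z⟩_z` at every closed `z ∈ Z`.
Then at EVERY `g ∈ Z ∩ F`: (T1) `𝓘⟨Z⟩_g ⊔ 𝓘⟨F⟩_g = 𝔪_{G,g}`, (T2) `𝓘⟨Z⟩_g ≠ 𝔪_{G,g}`, and `g` is a closed point.  Proof in the module docstring (a branch of
`Z` at `g` inside `F` has, by the Jacobson property, a closed point off the other branches, where the no-branch clause fails).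
[cite: StacksProject, Tag 01J7] [cite: StacksProject, Tag 005U] [cite: Matsumura1987, §5 with Thm. 1.1]
[OURS · L1 W4.5b · WIDTH TABLE D8, support debt S-D8-LIFT, (CL)-N bridge] -/
theorem crossing_stalkwise_of_curve_trace_jacobson {G : Scheme.{0}} [IsLocallyNoetherian G] [CompactSpace G] [JacobsonSpace G]
    {Z F : Set G} (hZ : IsClosed Z) (hF : IsClosed F)
    (hZdim : ∀ z : ↥(vanishingIdeal (⟨Z, hZ⟩ : Closeds G)).subscheme, IsClosed ({z} : Set ↥(vanishingIdeal (⟨Z, hZ⟩ : Closeds G)).subscheme) →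
      ringKrullDim ((vanishingIdeal (⟨Z, hZ⟩ : Closeds G)).subscheme.presheaf.stalk z) = ((1 : ℕ) : WithBot ℕ∞))
    (htr : vanishingIdeal (⟨F, hF⟩ : Closeds G) ⊔ vanishingIdeal (⟨Z, hZ⟩ : Closeds G) = vanishingIdeal (⟨F ∩ Z, hF.inter hZ⟩ : Closeds G))
    (hnc : ∀ z ∈ Z, IsClosed ({z} : Set G) →
      ¬ stalkIdeal (vanishingIdeal (⟨F, hF⟩ : Closeds G)) z ≤ stalkIdeal (vanishingIdeal (⟨Z, hZ⟩ : Closeds G)) z) :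
    (∀ g ∈ Z ∩ F, stalkIdeal (vanishingIdeal (⟨Z, hZ⟩ : Closeds G)) g ⊔ stalkIdeal (vanishingIdeal (⟨F, hF⟩ : Closeds G)) g =
        maximalIdeal (G.presheaf.stalk g)) ∧
      (∀ g ∈ Z ∩ F, stalkIdeal (vanishingIdeal (⟨Z, hZ⟩ : Closeds G)) g ≠ maximalIdeal (G.presheaf.stalk g)) ∧
      (∀ g ∈ Z ∩ F, IsClosed ({g} : Set G)) := by
  classical
  -- (N) NO BRANCH of `Z` lies inside `F`: at every `g ∈ Z`, no minimal prime of `𝓘⟨Z⟩_g` contains `𝓘⟨F⟩_g`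
  have hbranch : ∀ g ∈ Z, ∀ P ∈ (stalkIdeal (vanishingIdeal (⟨Z, hZ⟩ : Closeds G)) g).minimalPrimes,
      ¬ stalkIdeal (vanishingIdeal (⟨F, hF⟩ : Closeds G)) g ≤ P := by
    intro g _ P hP hJP
    obtain ⟨η, hη, hηZ, hmax, rfl⟩ := exists_isMax_of_mem_minimalPrimes hP
    have hηF : η ∈ ((⟨F, hF⟩ : Closeds G) : Set G) := mem_of_stalkIdeal_vanishingIdeal_le hη hJP
    -- the branch `Z₁ = cl{η} ⊆ Z ∩ F`
    set Z₁ : Set G := closure {η} with hZ₁def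
    have hZ₁Z : Z₁ ⊆ Z := closure_minimal (Set.singleton_subset_iff.mpr hηZ) hZ
    have hZ₁F : Z₁ ⊆ F := closure_minimal (Set.singleton_subset_iff.mpr hηF) hF
    have hηZ₁ : η ∈ Z₁ := subset_closure (Set.mem_singleton η)
    -- its generic point is off the other branches `W = closure (Z ∖ Z₁)`
    have hηW : η ∉ closure (Z \ Z₁) := by
      intro h
      have hlc : IsLocallyClosed (Z \ Z₁) := by
        rw [Set.sdiff_eq_compl_inter]
        exact isClosed_closure.isOpen_compl.isLocallyClosed.inter hZ.isLocallyClosed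
      obtain ⟨c, hcS, hcη⟩ :=
        Summit.ResolutionOfSingularities.ResolutionOfSingularities.Theorems.EquisingularLift.Scheme.exists_mem_specializes_of_mem_closure
          hlc h
      have hc : c = η := hmax c hcS.1 hcη
      exact hcS.2 (hc ▸ hηZ₁)
    -- Jacobson: a CLOSED point `z'` of the branch off the other branches
    have hlc' : IsLocallyClosed (Z₁ ∩ (closure (Z \ Z₁))ᶜ) :=
      isClosed_closure.isLocallyClosed.inter isClosed_closure.isOpen_compl.isLocallyClosed
    obtain ⟨z', ⟨hz'Z₁, hz'W⟩, hz'cl⟩ := nonempty_inter_closedPoints (Z := Z₁ ∩ (closure (Z \ Z₁))ᶜ) ⟨η, hηZ₁, hηW⟩ hlc'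
    rw [mem_closedPoints_iff] at hz'cl
    -- at `z'`: `𝓘⟨F⟩ ≤ 𝓘⟨Z₁⟩ ≤ 𝓘⟨Z⟩`, against the no-branch clause
    have h1 : stalkIdeal (vanishingIdeal (⟨F, hF⟩ : Closeds G)) z' ≤ stalkIdeal (vanishingIdeal (⟨Z₁, isClosed_closure⟩ : Closeds G)) z' :=
      stalkIdeal_mono (vanishingIdeal_antimono (show ((⟨Z₁, isClosed_closure⟩ : Closeds G) : Set G) ⊆ (⟨F, hF⟩ : Closeds G) from hZ₁F)) z'
    have h2 : stalkIdeal (vanishingIdeal (⟨Z₁, isClosed_closure⟩ : Closeds G)) z' ≤ stalkIdeal (vanishingIdeal (⟨Z, hZ⟩ : Closeds G)) z' :=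
      stalkIdeal_vanishingIdeal_le_of_notMem_closure_diff hZ isClosed_closure hz'W
    exact hnc z' (hZ₁Z hz'Z₁) hz'cl (h1.trans h2)
  -- (A) at the CLOSED crossing points
  have key : ∀ g ∈ Z ∩ F, IsClosed ({g} : Set G) →
      stalkIdeal (vanishingIdeal (⟨Z, hZ⟩ : Closeds G)) g ⊔ stalkIdeal (vanishingIdeal (⟨F, hF⟩ : Closeds G)) g =
          maximalIdeal (G.presheaf.stalk g) ∧
        stalkIdeal (vanishingIdeal (⟨Z, hZ⟩ : Closeds G)) g ≠ maximalIdeal (G.presheaf.stalk g) := by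
    rintro g ⟨hgZ, hgF⟩ hgcl
    have hgsupp : g ∈ ((vanishingIdeal (⟨Z, hZ⟩ : Closeds G) : G.IdealSheafData).support : Set G) := by
      rw [Scheme.IdealSheafData.coe_support_vanishingIdeal]; exact hgZ
    obtain ⟨s, hs⟩ : g ∈ Set.range (vanishingIdeal (⟨Z, hZ⟩ : Closeds G)).subschemeι := by
      rw [Scheme.IdealSheafData.range_subschemeι]; exact hgsupp
    subst hs
    have hsc : IsClosed ({s} : Set ↥(vanishingIdeal (⟨Z, hZ⟩ : Closeds G)).subscheme) := by
      have h1 : ({s} : Set ↥(vanishingIdeal (⟨Z, hZ⟩ : Closeds G)).subscheme) =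
          (vanishingIdeal (⟨Z, hZ⟩ : Closeds G)).subschemeι ⁻¹' {(vanishingIdeal (⟨Z, hZ⟩ : Closeds G)).subschemeι s} := by
        ext s'
        simp only [Set.mem_singleton_iff, Set.mem_preimage]
        exact ⟨fun h => by rw [h], fun h => (vanishingIdeal (⟨Z, hZ⟩ : Closeds G)).subschemeι.isClosedEmbedding.injective h⟩
      rw [h1]; exact hgcl.preimage (vanishingIdeal (⟨Z, hZ⟩ : Closeds G)).subschemeι.continuous
    -- notation: `g = ι s`, `I = 𝓘⟨Z⟩_g`, `J = 𝓘⟨F⟩_g`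
    set g : G := (vanishingIdeal (⟨Z, hZ⟩ : Closeds G)).subschemeι s with hg
    set I : Ideal (G.presheaf.stalk g) := stalkIdeal (vanishingIdeal (⟨Z, hZ⟩ : Closeds G)) g with hI
    set J : Ideal (G.presheaf.stalk g) := stalkIdeal (vanishingIdeal (⟨F, hF⟩ : Closeds G)) g with hJdef
    -- `𝒪_{G,g}/𝓘⟨Z⟩_g = 𝒪_{Z̃,g}` has dimension one
    have hdim : ringKrullDim (G.presheaf.stalk g ⧸ I) = 1 := by
      rw [hI, hg, ← ringKrullDim_stalk_subscheme]
      exact_mod_cast hZdim s hsc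
    refine ⟨?_, ne_maximalIdeal_of_ringKrullDim_quotient_eq_one hdim⟩
    -- (T1): the sum is `𝓘⟨F ∩ Z⟩_g`, radical and proper, and `J` lies in no minimal prime of `I`
    have hJ : I ⊔ J = stalkIdeal (vanishingIdeal (⟨F ∩ Z, hF.inter hZ⟩ : Closeds G)) g := by
      rw [hI, hJdef, sup_comm, ← stalkIdeal_sup, htr]
    have hrad : (I ⊔ J).IsRadical := by
      rw [hJ]; exact isRadical_stalkIdeal_vanishingIdeal _ _
    have hne : I ⊔ J ≠ ⊤ := by
      rw [hJ]
      have hmem : g ∈ (vanishingIdeal (⟨F ∩ Z, hF.inter hZ⟩ : Closeds G)).support := by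
        rw [← SetLike.mem_coe, Scheme.IdealSheafData.coe_support_vanishingIdeal]; exact ⟨hgF, hgZ⟩
      have hle := (mem_support_iff_stalkIdeal_le _ _).mp hmem
      exact fun h => (IsLocalRing.maximalIdeal.isMaximal _).ne_top (top_le_iff.mp (h ▸ hle))
    exact sup_eq_maximalIdeal_of_isRadical_of_forall_minimalPrimes hdim.le (hbranch g hgZ) hrad hne
  -- (B) every crossing point is closed
  have hclosed : ∀ g ∈ Z ∩ F, IsClosed ({g} : Set G) := by
    rintro g ⟨hgZ, hgF⟩
    obtain ⟨z, hgz, hzcl⟩ := exists_specializes_isClosed g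
    have hzZ : z ∈ Z := hgz.mem_closed hZ hgZ
    have hzF : z ∈ F := hgz.mem_closed hF hgF
    obtain ⟨hT1z, -⟩ := key z ⟨hzZ, hzF⟩ hzcl
    have h1 : stalkIdeal (vanishingIdeal (⟨Z, hZ⟩ : Closeds G)) z ≤ primeOfSpecializes hgz := stalkIdeal_vanishingIdeal_le hgz hgZ
    have h2 : stalkIdeal (vanishingIdeal (⟨F, hF⟩ : Closeds G)) z ≤ primeOfSpecializes hgz := stalkIdeal_vanishingIdeal_le hgz hgF
    have hm : maximalIdeal (G.presheaf.stalk z) ≤ primeOfSpecializes hgz := hT1z ▸ sup_le h1 h2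
    have hzg : z ⤳ g :=
      specializes_of_primeOfSpecializes_le hgz (specializes_refl z) (by rw [primeOfSpecializes_refl]; exact hm)
    have hgz' : g = z := by
      have h := hzg.mem_closure
      rw [hzcl.closure_eq, Set.mem_singleton_iff] at h
      exact h
    rw [hgz']; exact hzcl
  exact ⟨fun g hg => (key g hg (hclosed g hg)).1, fun g hg => (key g hg (hclosed g hg)).2, hclosed⟩

/-! ## (CL) with the model explicit, nodal version -/

section CrossedLetterNodal

variable (k : Type) [Field k] (O : Type) [CommRing O] [IsDomain O] [IsDiscreteValuationRing O] (θ : O →+* k)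

/-- **(CL)-N — a crossed letter steps to its strict transform, across a centre whose reduced trace `Z` is ANY reduced curve** (no regularity of `Z̃`):
✓ `TCPlus.crossedLetter_clauses` with the binder `hZreg` DROPPED, statement otherwise byte-identical — the five `LetterDatum` clauses of the new letter
`closure υ₂⁻¹(cl L ∖ Z)` for the model `strictTransformIdeal τ C 𝓛`.  The special fibre `G` is Jacobson because `tG : G ⟶ Spec k` is locally of finite
type (a base change of the proper `σ ≫ q`), and the bridge is `crossing_stalkwise_of_curve_trace_jacobson`; the rest of the proof is (CL)'s, verbatim.
[cite: GortzWedhorn2020, Prop. 13.91 and (13.19)] [cite: Matsumura1987, Thm. 14.2] [cite: StacksProject, Tag 01J7] [cite: StacksProject, Tag 005U]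
[OURS · L1 W4.5b · WIDTH TABLE D8, support debt S-D8-LIFT, (CL)-N] -/
theorem TCPlus.crossedLetter_clausesN (hθ : Function.Surjective θ) {P X X₂ G G₂ : Scheme.{0}} (q : P ⟶ Spec (.of O)) (Y : Set P) (σ : X ⟶ P)
    [IsLocallyNoetherian X] [IsIntegral X] [IsLocallyNoetherian X₂] [IsLocallyNoetherian G] [IsIntegral G₂] [IsProper (σ ≫ q)]
    (hX : Scheme.IsRegular X) (hX₂ : Scheme.IsRegular X₂)
    (jG : G ⟶ X) (tG : G ⟶ Spec (.of k)) (hsq : IsPullback jG tG (σ ≫ q) (Spec.map (CommRingCat.ofHom θ)))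
    -- the centre: regular, `O`-flat, `≠ ⊥`, reduced trace `𝓘⟨Z⟩`; `Z̃` with one-dimensional local rings at its closed points (NO regularity)
    (C : X.IdealSheafData) {Z : Set G} (hZ : IsClosed Z) (hCZ : C.comap jG = vanishingIdeal ⟨Z, hZ⟩) (hCfl : Flat (C.subschemeι ≫ σ ≫ q))
    (hCreg : Scheme.IsRegular C.subscheme) (hC0 : C ≠ ⊥)
    (hZdim : ∀ z : ↥(AlgebraicGeometry.Scheme.IdealSheafData.vanishingIdeal (⟨Z, hZ⟩ : TopologicalSpace.Closeds G)).subscheme, IsClosed ({z} : Set ↥(AlgebraicGeometry.Scheme.IdealSheafData.vanishingIdeal (⟨Z, hZ⟩ : TopologicalSpace.Closeds G)).subscheme) → ringKrullDim ((AlgebraicGeometry.Scheme.IdealSheafData.vanishingIdeal (⟨Z, hZ⟩ : TopologicalSpace.Closeds G)).subscheme.presheaf.stalk z) = ((1 : ℕ) : WithBot ℕ∞))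
    -- the round upstairs and downstairs, the new model square
    {τ : X₂ ⟶ X} (hτ : IsBlowup τ C) {υ₂ : G₂ ⟶ G} (hυ₂ : IsBlowup υ₂ (vanishingIdeal ⟨Z, hZ⟩))
    (j₂ : G₂ ⟶ X₂) (t₂ : G₂ ⟶ Spec (.of k)) (hsq₂ : IsPullback j₂ t₂ ((τ ≫ σ) ≫ q) (Spec.map (CommRingCat.ofHom θ))) (hcomm : j₂ ≫ τ = υ₂ ≫ jG)
    -- the letter with its model made explicit, crossed by the centre
    (L : Set G) (𝓛 : X.IdealSheafData) (hl1 : 𝓛.comap jG = vanishingIdeal ⟨closure L, isClosed_closure⟩)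
    (hl2 : ∀ z : X, (stalkIdeal 𝓛 z).IsPrincipal) (hl3 : Scheme.IsRegular 𝓛.subscheme)
    (hl4 : σ '' (𝓛.support : Set X) ⊆ {p : P | ¬ IsGenericPoint p Y}) (hl5 : Flat (𝓛.subschemeι ≫ σ ≫ q))
    (htr : vanishingIdeal (⟨closure L, isClosed_closure⟩ : Closeds G) ⊔ vanishingIdeal (⟨Z, hZ⟩ : Closeds G) =
      vanishingIdeal (⟨closure L ∩ Z, isClosed_closure.inter hZ⟩ : Closeds G))
    (hnc : ∀ z ∈ Z, IsClosed ({z} : Set G) →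
      ¬ stalkIdeal (vanishingIdeal (⟨closure L, isClosed_closure⟩ : Closeds G)) z ≤ stalkIdeal (vanishingIdeal (⟨Z, hZ⟩ : Closeds G)) z) :
    (strictTransformIdeal τ C 𝓛).comap j₂ = vanishingIdeal (⟨closure (υ₂ ⁻¹' (closure L \ Z)), isClosed_closure⟩ : Closeds G₂) ∧
      (∀ z : X₂, (stalkIdeal (strictTransformIdeal τ C 𝓛) z).IsPrincipal) ∧
      Scheme.IsRegular (strictTransformIdeal τ C 𝓛).subscheme ∧
      (τ ≫ σ) '' ((strictTransformIdeal τ C 𝓛).support : Set X₂) ⊆ {p : P | ¬ IsGenericPoint p Y} ∧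
      Flat ((strictTransformIdeal τ C 𝓛).subschemeι ≫ (τ ≫ σ) ≫ q) := by
  classical
  haveI : IsClosedImmersion (Spec.map (CommRingCat.ofHom θ)) := IsClosedImmersion.spec_of_surjective _ hθ
  haveI hjci : IsClosedImmersion jG := MorphismProperty.IsStableUnderBaseChange.of_isPullback hsq.flip inferInstance
  haveI : CompactSpace X := QuasiCompact.compactSpace_of_compactSpace (σ ≫ q)
  haveI : CompactSpace G := QuasiCompact.compactSpace_of_compactSpace jG
  -- the special fibre is Jacobson: locally of finite type over the field `k`
  haveI : LocallyOfFiniteType tG := MorphismProperty.IsStableUnderBaseChange.of_isPullback hsq inferInstance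
  haveI : JacobsonSpace G := LocallyOfFiniteType.jacobsonSpace tG
  -- (l-ii), (l-iv), (l-v) hold for the strict transform of any hypersurface model
  have hl2' : ∀ z : X₂, (stalkIdeal (strictTransformIdeal τ C 𝓛) z).IsPrincipal := fun z =>
    isPrincipal_stalkIdeal_strictTransformIdeal hX hCreg hτ hC0 𝓛 hl2 z
  have hl4' : (τ ≫ σ) '' ((strictTransformIdeal τ C 𝓛).support : Set X₂) ⊆ {p : P | ¬ IsGenericPoint p Y} := by
    rintro _ ⟨z, hz, rfl⟩
    exact hl4 ⟨τ z, apply_mem_support_of_mem_support_strictTransformIdeal 𝓛 hz, (Scheme.Hom.comp_apply τ σ z).symm⟩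
  have hl5' : Flat ((strictTransformIdeal τ C 𝓛).subschemeι ≫ (τ ≫ σ) ≫ q) :=
    flat_strictTransform_subschemeι_comp_stage O σ q τ C hτ 𝓛 hl5
  by_cases h0 : 𝓛 = ⊥
  · -- the degenerate model: `cl L = G`, hence `Z = ∅` (no closed point of `Z` survives `hnc`), and `St_C ⊥ = ⊥`
    subst h0
    have hLuniv : closure L = Set.univ := by
      have h := congrArg (fun I : G.IdealSheafData => ((I.support : Closeds G) : Set G)) hl1
      simp only [Scheme.IdealSheafData.comap_bot, Scheme.IdealSheafData.support_bot, Closeds.coe_top,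
        Scheme.IdealSheafData.coe_support_vanishingIdeal] at h
      exact h.symm
    have hZe : Z = ∅ := by
      by_contra hne
      obtain ⟨z, hz, hzcl⟩ := hZ.exists_closed_singleton (Set.nonempty_iff_ne_empty.mpr hne)
      apply hnc z hz hzcl
      rw [← hl1, Scheme.IdealSheafData.comap_bot]
      have hb : stalkIdeal (⊥ : G.IdealSheafData) z = ⊥ := by
        obtain ⟨U, hU, hzU, -⟩ := exists_isAffineOpen_mem_and_subset (X := G) (x := z) (U := ⊤) (Opens.mem_top z)
        rw [stalkIdeal_eq_map_germ _ ⟨U, hU⟩ hzU, Scheme.IdealSheafData.ideal_bot, Pi.bot_apply, Ideal.map_bot]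
      rw [hb]; exact bot_le
    have hSt : strictTransformIdeal τ C (⊥ : X.IdealSheafData) = ⊥ := strictTransformIdeal_bot hτ
    refine ⟨?_, hl2', ?_, hl4', hl5'⟩
    · rw [hSt, Scheme.IdealSheafData.comap_bot]
      have hset : closure (υ₂ ⁻¹' (closure L \ Z)) = Set.univ := by
        rw [hLuniv, hZe, Set.sdiff_empty, Set.preimage_univ, closure_univ]
      have htop : (⟨closure (υ₂ ⁻¹' (closure L \ Z)), isClosed_closure⟩ : Closeds G₂) = ⊤ := Closeds.ext hset
      rw [htop, vanishingIdeal_top, Scheme.nilradical_eq_bot]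
    · rw [hSt]
      haveI : IsIso (⊥ : X₂.IdealSheafData).subschemeι := (Scheme.isIso_subschemeι_iff_eq_bot _).mpr rfl
      exact Scheme.IsRegular.of_isOpenImmersion (⊥ : X₂.IdealSheafData).subschemeι hX₂
  · -- the crossed letter: (T1)/(T2) by the NODAL bridge, snc by (A′-1), regularity by (A′-2), the trace by (A′-3)
    obtain ⟨hT1, hT2, -⟩ := crossing_stalkwise_of_curve_trace_jacobson hZ isClosed_closure hZdim htr hnc
    have hE : HasSNCWith [𝓛] C := hasSNCWith_member_centre_of_trace_transversal hX hsq hθ hCZ hCreg hl1 hl2 hl3 h0 hT1 hT2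
    exact ⟨comap_strictTransformIdeal_eq_vanishingIdeal_of_transversal' hsq hθ hτ hυ₂ hcomm hsq₂ hCZ hCfl hT1 hT2 hl1 hE, hl2',
      isRegular_subscheme_strictTransformIdeal_of_hasSNCWith hE hτ, hl4', hl5'⟩

end CrossedLetterNodal

end Summit.ResolutionOfSingularities.ResolutionOfSingularities.Cruxes.EquisingularLiftNat.Sections

end
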